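import Mathlib
import HarnessLib
import Summits.NavierStokesRegularity.NavierStokesRegularity.Theorems.UnthreadedDoorAntidynamoWallHFormObstruction
import Summits.NavierStokesRegularity.NavierStokesRegularity.Theorems.UnthreadedDoorAntidynamoWallCentrePathAnalytic

/-!
# Route `UnthreadedDoor` / `ThreadingFlux`, crux `PoloidalLiouville` (stmt-NavierStokesRegularity-1222), antidynamo v2 skeleton (sha16 `4ebf5683127b`),
# WALL `stub_scalarLiouville`: the H-form gauge obstruction is an EXACT criterion (converse of `HForm.hform_obstruction_of_gauge`)

Support file (seat leafhand-ns-unthreadeddoor-2 g3, cell decomp-ns), `--supports stmt-NavierStokesRegularity-1222 --as helper`; theorems only.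

`…WallHFormObstruction` (p821522) proved: a gauge value `g` with `(q + a × p + g (a × y)) × y = 0` forces the obstruction
`−‖y‖⁴⟪q,a⟫ + ‖y‖²⟪a,y⟫⟪q,y⟫ − ‖y‖²⟪a,y⟫⟪y, p × a⟫` to vanish.  Here the converse: off the degenerate locus `(a × y) × y = 0` (i.e. where
`∇φ` has a non-zero component tangent to the sphere, `∇_S φ ≠ 0`), vanishing of the obstruction PRODUCES a gauge value — so at such points
«a KNSS-type gauge exists» ⟺ «`Hess_{S_r}φ(J∇_S T, ∇_S φ) = 0`» exactly (memo `WALL-STATUS-leafhand2-g3.md` §6a).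

* `HForm.cross_eq_zero_of_orthogonal` — two vectors orthogonal to `y ≠ 0` whose cross product is orthogonal to `y` have zero cross product;
* `HForm.exists_smul_of_cross_eq_zero` — `u₁ ≠ 0`, `u₀ × u₁ = 0` ⇒ `u₀ = μ • u₁` (BAC−CAB, `OneInstant.inner_self_smul_eq`);
* ★ `HForm.exists_gauge_of_obstruction_eq_zero`, `HForm.exists_gauge_iff_obstruction_eq_zero`.

HONEST LABEL: vector algebra; nothing here proves `stub_scalarLiouville`, `PoloidalLiouville` (1222), or bears on Navier–Stokes regularity; no summit
statement is proved. [folklore] [cite: KochNadirashviliSereginSverak2009, Thm 5.2 (arXiv:0709.3599 pp. 9–10); MajdaBertozziCUP2002, §1.1 (vector identities)]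
-/

noncomputable section

-- the summit and its single sub-problem share the name (CONVENTIONS §1)
set_option linter.dupNamespace false

open scoped InnerProductSpace RealInnerProductSpace
open Literature.Analysis.FluidPDE

namespace Summit.NavierStokesRegularity.NavierStokesRegularity.Theorems.PoloidalLiouville.Antidynamo

namespace HForm

open Summit.NavierStokesRegularity.NavierStokesRegularity.Theorems.PoloidalLiouville.HorizonTower.Zonal
  (inner_cross_self_left inner_cross_self_right)

/-- Linearity of the gauge equation in `g`: `(q + a × p + g (a × y)) × y = (q + a × p) × y + g ((a × y) × y)`. [folklore] -/
theorem cross_gauge_eq (y a p q : EuclideanSpace ℝ (Fin 3)) (g : ℝ) :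
    cross (q + cross a p + g • cross a y) y = cross (q + cross a p) y + g • cross (cross a y) y := by
  ext i
  fin_cases i <;> simp [cross, crossProduct, Matrix.vecHead, Matrix.vecTail] <;> ring

/-- Two vectors orthogonal to `y ≠ 0` whose cross product is orthogonal to `y` have ZERO cross product (their cross product is parallel to `y`).
[folklore] -/
theorem cross_eq_zero_of_orthogonal {y u₀ u₁ : EuclideanSpace ℝ (Fin 3)} (hy : y ≠ 0)
    (h₀ : ⟪u₀, y⟫ = 0) (h₁ : ⟪u₁, y⟫ = 0) (h : ⟪cross u₀ u₁, y⟫ = 0) : cross u₀ u₁ = 0 := by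
  -- `(u₀ × u₁) × y = ⟪u₀, y⟫ u₁ − ⟪u₁, y⟫ u₀ = 0`, so `‖y‖² (u₀ × u₁) = ⟪y, u₀ × u₁⟫ y − y × (y × (u₀ × u₁)) = 0`
  have hc : cross (cross u₀ u₁) y = 0 := by
    have e : cross (cross u₀ u₁) y = ⟪u₀, y⟫ • u₁ - ⟪u₁, y⟫ • u₀ := by
      ext i
      fin_cases i <;> simp [cross, crossProduct, PiLp.inner_apply, Fin.sum_univ_three] <;> ring
    rw [e, h₀, h₁, zero_smul, zero_smul, sub_zero]
  have hyc : cross y (cross y (cross u₀ u₁)) = 0 := by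
    have e : cross y (cross u₀ u₁) = -cross (cross u₀ u₁) y := by
      ext i
      fin_cases i <;> simp [cross, crossProduct] <;> ring
    rw [e, hc, neg_zero]
    ext i
    fin_cases i <;> simp [cross, crossProduct]
  have key := OneInstant.inner_self_smul_eq y (cross u₀ u₁)
  rw [hyc, sub_zero, real_inner_comm (cross u₀ u₁) y, h, zero_smul] at key
  have hyy : ⟪y, y⟫ ≠ 0 := fun h0 => hy (inner_self_eq_zero.1 h0)
  exact (smul_eq_zero.1 key).resolve_left hyy

/-- `u₁ ≠ 0` and `u₀ × u₁ = 0` ⇒ `u₀ = μ • u₁` for some `μ` (BAC−CAB: `‖u₁‖² u₀ = ⟪u₁, u₀⟫ u₁ − u₁ × (u₁ × u₀)`). [folklore] -/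
theorem exists_smul_of_cross_eq_zero {u₀ u₁ : EuclideanSpace ℝ (Fin 3)} (h₁ : u₁ ≠ 0) (h : cross u₀ u₁ = 0) :
    ∃ μ : ℝ, u₀ = μ • u₁ := by
  have key := OneInstant.inner_self_smul_eq u₁ u₀
  have hc : cross u₁ (cross u₁ u₀) = 0 := by
    have e : cross u₁ u₀ = -cross u₀ u₁ := by
      ext i
      fin_cases i <;> simp [cross, crossProduct] <;> ring
    rw [e, h, neg_zero]
    ext i
    fin_cases i <;> simp [cross, crossProduct]
  rw [hc, sub_zero] at key
  have h11 : ⟪u₁, u₁⟫ ≠ 0 := fun h0 => h₁ (inner_self_eq_zero.1 h0)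
  refine ⟨⟪u₁, u₀⟫ / ⟪u₁, u₁⟫, ?_⟩
  have e2 : (⟪u₁, u₀⟫ / ⟪u₁, u₁⟫) • u₁ = (⟪u₁, u₁⟫)⁻¹ • (⟪u₁, u₀⟫ • u₁) := by
    rw [smul_smul, div_eq_inv_mul]
  rw [e2, ← key, smul_smul, inv_mul_cancel₀ h11, one_smul]

/-- ★ **Converse: off the degenerate locus, a vanishing obstruction produces a gauge value.**  If `(a × y) × y ≠ 0` (the tangential part of `a`
does not vanish) and `−‖y‖⁴⟪q,a⟫ + ‖y‖²⟪a,y⟫⟪q,y⟫ − ‖y‖²⟪a,y⟫⟪y, p × a⟫ = 0`, then `(q + a × p + g (a × y)) × y = 0` for some `g : ℝ`. [folklore] -/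
theorem exists_gauge_of_obstruction_eq_zero {y a p q : EuclideanSpace ℝ (Fin 3)} (hne : cross (cross a y) y ≠ 0)
    (h : -(‖y‖ ^ 2) ^ 2 * ⟪q, a⟫ + ‖y‖ ^ 2 * ⟪a, y⟫ * ⟪q, y⟫ - ‖y‖ ^ 2 * ⟪a, y⟫ * ⟪y, cross p a⟫ = 0) :
    ∃ g : ℝ, cross (q + cross a p + g • cross a y) y = 0 := by
  have hy : y ≠ 0 := by
    rintro rfl
    apply hne
    ext i
    fin_cases i <;> simp [cross, crossProduct]
  rw [← hform_obstruction_identity] at h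
  have h0 := cross_eq_zero_of_orthogonal hy (inner_cross_self_right _ y) (inner_cross_self_right _ y) h
  obtain ⟨μ, hμ⟩ := exists_smul_of_cross_eq_zero hne h0
  refine ⟨-μ, ?_⟩
  rw [cross_gauge_eq, hμ, neg_smul, add_neg_cancel]

/-- ★ **The exact criterion**: off the degenerate locus `(a × y) × y = 0`, a gauge value exists iff the obstruction vanishes. [folklore] -/
theorem exists_gauge_iff_obstruction_eq_zero {y a p q : EuclideanSpace ℝ (Fin 3)} (hne : cross (cross a y) y ≠ 0) :
    (∃ g : ℝ, cross (q + cross a p + g • cross a y) y = 0) ↔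
      -(‖y‖ ^ 2) ^ 2 * ⟪q, a⟫ + ‖y‖ ^ 2 * ⟪a, y⟫ * ⟪q, y⟫ - ‖y‖ ^ 2 * ⟪a, y⟫ * ⟪y, cross p a⟫ = 0 :=
  ⟨fun ⟨_, hg⟩ => hform_obstruction_of_gauge hg, exists_gauge_of_obstruction_eq_zero hne⟩

end HForm

end Summit.NavierStokesRegularity.NavierStokesRegularity.Theorems.PoloidalLiouville.Antidynamo

end
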